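import Literature.Geometry.Lorentzian.KerrConvergence
import Literature.Geometry.Lorentzian.HypersurfaceRestriction
import Literature.Geometry.Lorentzian.IsometryProofs
import Literature.Geometry.Lorentzian.KerrSchildCoord
import HarnessLib

/-!
# Convergence to Kerr / Minkowski: proofs (companion to `KerrConvergence.lean`)

Discharges the named fact
`Literature.Geometry.Lorentzian.Spacetime.deviation_minkowskiBackground_comp_subtypeVal` of
`KerrConvergence.lean`: the generic metric deviation from `Minkowski.background` of a chart map
restricted to the open submanifold `⊤ ⊆ E4`, `Ψ ∘ Subtype.val`, is `minkowskiDeviation Ψ`.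

Both sides are `g(dΦ ·, dΦ ·) − η` with `Φ = Ψ ∘ ι`, resp. `Φ = Ψ` (`deviation_apply`,
`minkowskiDeviation_apply`), so the content is the **unconditional chain rule for the
restriction to an open submanifold**, `d(f ∘ ι)_y = df_{↑y}` (`mfderiv_comp_subtypeVal'`):
when `f` is differentiable at `↑y` this is the tree's `mfderiv_comp_subtypeVal`
(`HypersurfaceRestriction.lean`, `dι = id`; Lee, *Introduction to Smooth Manifolds*, Prop. 3.9),
and otherwise neither side is differentiable (`mdifferentiableAt_comp_subtypeVal_iff`, from
Mathlib's `StructureGroupoid.LocalInvariantProp.liftPropAt_iff_comp_subtype_val`: the chart of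
`W` at `y` is the restricted chart of `N` at `↑y`), so both differentials are Mathlib's junk
value `0`.

## Discharge of `nonempty_finalStateDecomposition_of_convergesToKerr`

`KerrConvergence.lean` also vendors the consequence-form notion of convergence to Kerr (`Spacetime.ConvergesToKerr`, DHRT
arXiv:2104.08222, §1) and the hypothesis structure `FinalStateDecomposition` of the `N`-black-hole
final state, and records as the named fact `nonempty_finalStateDecomposition_of_convergesToKerr`
the sanity statement "convergence to Kerr `(M, a)` with `0 < M`, `|a| ≤ M` in `𝒟` yields an
`N = 1` decomposition". This file PROVES it
(`nonempty_finalStateDecomposition_of_convergesToKerr_holds`), everything else being proved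
support:

* **Restriction of charts** (`Spacetime.deviation_backgroundOn_comp_inclusion`,
  `isLateChart_backgroundOn_comp_inclusion`): for `U ≤ Kerr.exterior M a` the flat chart is
  `Ψ|_U`, the differential of the inclusion of open subsets of `E4` is the identity
  (`OpensChart.mfderiv_inclusion_apply`), so `(Ψ|_U)^* g − η = (Ψ^* g − g_{M,a}) + (g_{M,a} − η)`.
* **Smoothness of the deviation** (`Spacetime.contDiffAt_deviationExtend_kerr`): the pullback
  `Ψ^* g` is a smooth section of the bundle of bilinear forms (`contMDiff_pullbackBilin_holds`,
  O'Neill 1983, Ch. 3), i.e. its components are smooth (`OpensChart.contMDiffAt_bilinSection_iff`),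
  and `g_{M,a}` is smooth on `{r > 0}` (`Kerr.contDiffAt_bilin`); hence the sum rule for
  `iteratedFDeriv` applies on `U`.
* **Decay of all derivatives of the Kerr–Schild term** (`Kerr.norm_iteratedFDeriv_ksPert_le`:
  `‖D^m (g_{M,a} − η)(x)‖ ≤ C_m / r(x)` for `r(x) ≥ R_m`), by *scaling*: the Kerr–Schild data are
  homogeneous, `r_{εa}(εx) = ε r_a(x)`, `ε M H_{1,εa}(εx) = H_{M,a}(x)`, `ℓ_{εa}(εx) = ℓ_a(x)`
  (Visser arXiv:0706.0622, (33)–(35)), so `(g_{M,a} − η)(x) = ε M (g_{1,εa} − η)(εx)` and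
  `‖D^m(g_{M,a} − η)(x)‖ ≤ ε^{m+1} |M| ‖D^m (g_{1,εa} − η)(εx)‖` with `ε = 1/‖x⃗‖`; the last factor is
  bounded on the compact set `|a'| ≤ 1/2`, `y⁰ = 0`, `‖y⃗‖ = 1` because `(a', y) ↦ (g_{1,a'} − η)(y)`
  is jointly smooth on `{r > 0}` (`Kerr.contDiffAt_ksPert₂`) — time translations being harmless
  as the form is stationary — and `r ≤ ‖x⃗‖` (`Kerr.radius_le_spatialNorm`).
* **The radiation zone** (`Spacetime.tendsto_deviationCk_backgroundOn`): on
  `U = {x⁰ > τ₀, r > ρ(x⁰)}` with `ρ → ∞` the `Cᵏ` deviation of `Ψ|_U` from `η` is at most the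
  `Cᵏ` deviation of `Ψ` from `g_{M,a}` plus `C/ρ(τ)`, both tending to `0`.
* **Assembly**: motion `(1, 0)` (`boostedKerrBackground_one_zero`), excision
  `ρ(t) = max(r₊, 0) + 1 + √t` (so that `U ⊆ Kerr.exterior` and `ρ(t)/t → 0`), separation vacuous,
  covering clause from `IsLateEmbedding.diff_subset_causalPast` and monotonicity of `J⁻`.

## References

* J. M. Lee, *Introduction to Smooth Manifolds*, 2nd ed., Springer GTM 218 (2013), Prop. 3.9
  (for an open submanifold `W ⊆ N`, `dι_y : T_y W → T_{↑y} N` is an isomorphism).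
* D. Christodoulou, S. Klainerman, *The global nonlinear stability of the Minkowski space*,
  Princeton 1993, Thm. 1.0.2 (the deviation `g − η`).
* M. Dafermos, G. Holzegel, I. Rodnianski, M. Taylor, *The non-linear stability of the
  Schwarzschild family of black holes*, arXiv:2104.08222, §1 (key `arXiv210408222`).
* R. P. Kerr, A. Schild, *A new class of vacuum solutions of the Einstein field equations*
  (1965), §2–§3 (key `KerrSchild1965`); M. Visser, arXiv:0706.0622, (32)–(35).
* B. O'Neill, *Semi-Riemannian geometry*, Academic Press 1983, Ch. 3, p. 58 (key `ONeill1983`).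
-/

noncomputable section

open TopologicalSpace Manifold

universe u

namespace Literature.Geometry.Lorentzian

/-! ### Restriction to an open submanifold: differentials, junk values included -/

section SubtypeVal

variable {E : Type*} [NormedAddCommGroup E] [NormedSpace ℝ E] {H : Type*} [TopologicalSpace H]
  {I : ModelWithCorners ℝ E H} {M : Type*} [TopologicalSpace M] [ChartedSpace H M]
  {E' : Type*} [NormedAddCommGroup E'] [NormedSpace ℝ E'] {H' : Type*} [TopologicalSpace H']
  {I' : ModelWithCorners ℝ E' H'} {N : Type*} [TopologicalSpace N] [ChartedSpace H' N]
  {W : TopologicalSpace.Opens N}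

/-- A map `f : N → M` restricted to an open submanifold `W ⊆ N` is differentiable at `y ∈ W` iff
`f` is differentiable at `↑y` (differentiability is a local invariant property, and the chart of
`W` at `y` is the restricted chart of `N` at `↑y`; Mathlib's
`StructureGroupoid.LocalInvariantProp.liftPropAt_iff_comp_subtype_val`, cf.
`contMDiffAt_subtype_iff`). Lee, *Introduction to Smooth Manifolds* (2013), Prop. 3.9.
[cite: LeeSmoothManifolds2013, Prop. 3.9] -/
theorem mdifferentiableAt_comp_subtypeVal_iff {f : N → M} {y : W} :
    MDifferentiableAt I' I (f ∘ Subtype.val : W → M) y ↔ MDifferentiableAt I' I f y.1 :=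
  (differentiableWithinAt_localInvariantProp.liftPropAt_iff_comp_subtype_val f y).symm

/-- **Unconditional chain rule for the restriction to an open subset**: the differential of
`f|_W = f ∘ ι` at `y ∈ W` is the differential of `f` at `↑y` — including Mathlib's junk value
`0` when `f` is not differentiable at `↑y`, for then neither is `f ∘ ι` at `y`
(`mdifferentiableAt_comp_subtypeVal_iff`); the differentiable case is
`mfderiv_comp_subtypeVal` (`HypersurfaceRestriction.lean`, `dι = id`). Lee, *Introduction to
Smooth Manifolds* (2013), Prop. 3.9 (`dι_y : T_y W → T_{↑y} N` is an isomorphism, the identity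
in the preferred charts). [cite: LeeSmoothManifolds2013, Prop. 3.9] -/
theorem mfderiv_comp_subtypeVal' (f : N → M) (y : W) :
    mfderiv I' I (f ∘ Subtype.val : W → M) y = mfderiv I' I f y.1 := by
  by_cases hf : MDifferentiableAt I' I f y.1
  · exact mfderiv_comp_subtypeVal hf
  · rw [mfderiv_zero_of_not_mdifferentiableAt hf,
      mfderiv_zero_of_not_mdifferentiableAt (mt mdifferentiableAt_comp_subtypeVal_iff.mp hf)]
    rfl

end SubtypeVal

/-! ### Discharge -/

namespace Spacetime

variable (𝓢 : Spacetime.{u} 4)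

/-- **Discharge of `deviation_minkowskiBackground_comp_subtypeVal`.** The generic deviation from
`Minkowski.background` of `Ψ ∘ Subtype.val` equals `minkowskiDeviation Ψ`: both sides are
`g(dΦ ·, dΦ ·) − η` with `Φ = Ψ ∘ ι`, resp. `Φ = Ψ` (`deviation_apply`,
`minkowskiDeviation_apply`; `Minkowski.background.bilin _ = η` definitionally), and
`d(Ψ ∘ ι)_x = dΨ_{↑x}` on the open submanifold `⊤ ⊆ E4`, junk values included
(`mfderiv_comp_subtypeVal'`). Lee, *Introduction to Smooth Manifolds* (2013), Prop. 3.9;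
the deviation `g − η` itself is that of Christodoulou–Klainerman 1993, Thm. 1.0.2.
[cite: LeeSmoothManifolds2013, Prop. 3.9] -/
theorem deviation_minkowskiBackground_comp_subtypeVal_holds :
    𝓢.deviation_minkowskiBackground_comp_subtypeVal := by
  intro Ψ x
  ext v w
  rw [deviation_apply, minkowskiDeviation_apply, mfderiv_comp_subtypeVal']
  rfl

end Spacetime

/-! ## Discharge of `nonempty_finalStateDecomposition_of_convergesToKerr` -/

open Filter Topology Set Function Bundle
open scoped ContDiff Topology Manifold

/-! ### Inclusions of open subsets of a normed space: derivative -/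

section OpensIncl

variable {E : Type*} [NormedAddCommGroup E] [NormedSpace ℝ E]

/-- The manifold derivative of the inclusion `U → E` of an open subset is the identity.
[folklore] -/
theorem OpensChart.mfderiv_subtypeVal_apply {U : Opens E} (x : U) (v : TangentSpace 𝓘(ℝ, E) x) :
    mfderiv 𝓘(ℝ, E) 𝓘(ℝ, E) (Subtype.val : U → E) x v = v := by
  have h := OpensChart.mfderiv_extChartAt_apply x v
  rwa [OpensChart.extChartAt_coe] at h

/-- The manifold derivative of the inclusion `U → V` of open subsets `U ≤ V` of a normed space
is the identity (chain rule along `U → V → E`). [folklore] -/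
theorem OpensChart.mfderiv_inclusion_apply {U V : Opens E} (h : U ≤ V) (x : U)
    (v : TangentSpace 𝓘(ℝ, E) x) :
    mfderiv 𝓘(ℝ, E) 𝓘(ℝ, E) (Opens.inclusion h) x v = v := by
  have h1 : MDifferentiableAt 𝓘(ℝ, E) 𝓘(ℝ, E) (Subtype.val : V → E) (Opens.inclusion h x) :=
    (contMDiff_subtype_val (I := 𝓘(ℝ, E)) (n := ∞)).mdifferentiableAt (by simp)
  have h2 : MDifferentiableAt 𝓘(ℝ, E) 𝓘(ℝ, E) (Opens.inclusion h) x :=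
    (contMDiff_inclusion (I := 𝓘(ℝ, E)) (n := ∞) h).mdifferentiableAt (by simp)
  have hc := mfderiv_comp x h1 h2
  have hval : (Subtype.val : V → E) ∘ Opens.inclusion h = (Subtype.val : U → E) := rfl
  rw [hval] at hc
  have h3 := DFunLike.congr_fun hc v
  have e1 := mfderiv_subtypeVal_apply x v
  have e2 := mfderiv_subtypeVal_apply (Opens.inclusion h x)
    (mfderiv 𝓘(ℝ, E) 𝓘(ℝ, E) (Opens.inclusion h) x v)
  exact e2.symm.trans (h3.symm.trans e1)

end OpensIncl

/-! ### Late-time charts restricted to smaller open domains -/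

namespace Spacetime

variable (𝓢 : Spacetime.{u} 4)

/-- In a Kerr late-time chart `Ψ` restricted to `U ⊆ Kerr.exterior M a`, the deviation from the
*Minkowski* background is the deviation from Kerr plus the Kerr–Schild perturbation:
`Ψ^* g − η = (Ψ^* g − g_{M,a}) + (g_{M,a} − η)` (chain rule for pullbacks along the inclusion,
whose differential is the identity; DHRT arXiv:2104.08222, §1 for the deviation).
[cite: arXiv210408222, §1] -/
theorem deviation_backgroundOn_comp_inclusion {M a : ℝ} {U : Opens E4}
    (h : (Minkowski.backgroundOn U).domain ≤ (Kerr.background M a).domain)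
    {Ψ : (Kerr.background M a).domain → 𝓢.carrier} (hΨ : ContMDiff 𝓘(ℝ, E4) (𝓡 4) ∞ Ψ)
    (x : (Minkowski.backgroundOn U).domain) :
    𝓢.deviation (Minkowski.backgroundOn U) (Ψ ∘ Opens.inclusion h) x =
      𝓢.deviation (Kerr.background M a) Ψ (Opens.inclusion h x) +
        (Kerr.bilin M a x.1 - Minkowski.bilin) := by
  have hΨd : MDifferentiable 𝓘(ℝ, E4) (𝓡 4) Ψ := hΨ.mdifferentiable (by simp)
  have hid : MDifferentiable 𝓘(ℝ, E4) 𝓘(ℝ, E4) (Opens.inclusion h) :=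
    (contMDiff_inclusion (n := ∞) h).mdifferentiable (by simp)
  have hcomp := congrFun (pullbackBilin_comp (I' := 𝓘(ℝ, E4)) (I := 𝓘(ℝ, E4)) (I'' := 𝓡 4)
    hΨd hid 𝓢.metric.val) x
  have e1 : ∀ v w : E4,
      pullbackBilin (I := 𝓡 4) (I' := 𝓘(ℝ, E4)) (Ψ ∘ Opens.inclusion h) 𝓢.metric.val x v w =
        pullbackBilin (I := 𝓡 4) (I' := 𝓘(ℝ, E4)) Ψ 𝓢.metric.val (Opens.inclusion h x) v w :=
    fun v w ↦ (DFunLike.congr_fun (DFunLike.congr_fun hcomp v) w).trans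
      (congrArg₂ (fun u u' ↦ pullbackBilin (I := 𝓡 4) (I' := 𝓘(ℝ, E4)) Ψ 𝓢.metric.val
        (Opens.inclusion h x) u u')
        (OpensChart.mfderiv_inclusion_apply h x v) (OpensChart.mfderiv_inclusion_apply h x w))
  refine ContinuousLinearMap.ext fun v ↦ ContinuousLinearMap.ext fun w ↦ ?_
  change pullbackBilin (I := 𝓡 4) (I' := 𝓘(ℝ, E4)) (Ψ ∘ Opens.inclusion h) 𝓢.metric.val x v w -
      Minkowski.bilin v w =
    pullbackBilin (I := 𝓡 4) (I' := 𝓘(ℝ, E4)) Ψ 𝓢.metric.val (Opens.inclusion h x) v w -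
      Kerr.bilin M a x.1 v w + (Kerr.bilin M a x.1 v w - Minkowski.bilin v w)
  rw [e1]
  ring

/-- Extended-by-zero form of `deviation_backgroundOn_comp_inclusion`: on `U` the two extended
deviations differ by the Kerr–Schild perturbation (DHRT arXiv:2104.08222, §1).
[cite: arXiv210408222, §1] -/
theorem deviationExtend_backgroundOn_comp_inclusion {M a : ℝ} {U : Opens E4}
    (h : (Minkowski.backgroundOn U).domain ≤ (Kerr.background M a).domain)
    {Ψ : (Kerr.background M a).domain → 𝓢.carrier} (hΨ : ContMDiff 𝓘(ℝ, E4) (𝓡 4) ∞ Ψ)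
    {z : E4} (hz : z ∈ U) :
    𝓢.deviationExtend (Minkowski.backgroundOn U) (Ψ ∘ Opens.inclusion h) z =
      𝓢.deviationExtend (Kerr.background M a) Ψ z + (Kerr.bilin M a z - Minkowski.bilin) := by
  have hz' : z ∈ (Minkowski.backgroundOn U).domain := hz
  have e1 := 𝓢.deviationExtend_coe (Minkowski.backgroundOn U) (Ψ ∘ Opens.inclusion h) ⟨z, hz'⟩
  have e2 := 𝓢.deviationExtend_coe (Kerr.background M a) Ψ (Opens.inclusion h ⟨z, hz'⟩)
  exact e1.trans ((𝓢.deviation_backgroundOn_comp_inclusion h hΨ ⟨z, hz'⟩).trans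
    (congrArg (· + (Kerr.bilin M a z - Minkowski.bilin)) e2.symm))

/-- Near a point of the open set `U`, the extended flat deviation of `Ψ ∘ (U ↪ Kerr.exterior)`
agrees with the extended Kerr deviation plus the Kerr–Schild perturbation
(DHRT arXiv:2104.08222, §1). [cite: arXiv210408222, §1] -/
theorem deviationExtend_backgroundOn_eventuallyEq {M a : ℝ} {U : Opens E4}
    (h : (Minkowski.backgroundOn U).domain ≤ (Kerr.background M a).domain)
    {Ψ : (Kerr.background M a).domain → 𝓢.carrier} (hΨ : ContMDiff 𝓘(ℝ, E4) (𝓡 4) ∞ Ψ)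
    {z : E4} (hz : z ∈ U) :
    𝓢.deviationExtend (Minkowski.backgroundOn U) (Ψ ∘ Opens.inclusion h) =ᶠ[𝓝 z]
      fun y ↦ 𝓢.deviationExtend (Kerr.background M a) Ψ y + (Kerr.bilin M a y - Minkowski.bilin) := by
  filter_upwards [U.2.mem_nhds hz] with y hy
  exact 𝓢.deviationExtend_backgroundOn_comp_inclusion h hΨ hy

/-- **The extended Kerr deviation `Ψ^* g − g_{M,a}` of a smooth chart map is `C^∞` at every point
of the Kerr exterior**: the pullback `Ψ^* g` is a smooth section of the bundle of bilinear forms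
(`contMDiff_pullbackBilin_holds`, O'Neill 1983, Ch. 3, Lemma 3.35 ff.), which over an open subset
of `E4` means that its components are smooth (`OpensChart.contMDiffAt_bilinSection_iff`), and the
Kerr–Schild components are smooth on `{r > 0}` (`Kerr.contDiffAt_bilin`).
[cite: ONeill1983, Ch. 3, Lemma 3.35] -/
theorem contDiffAt_deviationExtend_kerr {M a : ℝ} {Ψ : (Kerr.background M a).domain → 𝓢.carrier}
    (hΨ : ContMDiff 𝓘(ℝ, E4) (𝓡 4) ∞ Ψ) (x : (Kerr.background M a).domain) :
    ContDiffAt ℝ ∞ (𝓢.deviationExtend (Kerr.background M a) Ψ) x := by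
  set G : E4 → E4 →L[ℝ] E4 →L[ℝ] ℝ :=
    fun z ↦ 𝓢.deviationExtend (Kerr.background M a) Ψ z + Kerr.bilin M a z with hG
  have hsec := PseudoRiemannianMetric.contMDiff_pullbackBilin_holds (I := 𝓡 4) (M := 𝓢.carrier)
    (I' := 𝓘(ℝ, E4)) (N := (Kerr.background M a).domain) (n := ∞) Ψ hΨ
    𝓢.metric.toPseudoRiemannianMetric
  have hGs : ContDiffAt ℝ ∞ G x := by
    refine (OpensChart.contMDiffAt_bilinSection_iff x
      (fun y ↦ pullbackBilin (I := 𝓡 4) (I' := 𝓘(ℝ, E4)) Ψ 𝓢.metric.val y) G fun y ↦ ?_).1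
      (hsec x)
    have hy := 𝓢.deviationExtend_coe (Kerr.background M a) Ψ y
    have e : ∀ v w : E4, G y v w = pullbackBilin (I := 𝓡 4) (I' := 𝓘(ℝ, E4)) Ψ 𝓢.metric.val
        y v w := by
      intro v w
      have h1 : G y v w = 𝓢.deviationExtend (Kerr.background M a) Ψ y v w + Kerr.bilin M a y v w :=
        rfl
      have h2 : 𝓢.deviationExtend (Kerr.background M a) Ψ y v w =
          𝓢.deviation (Kerr.background M a) Ψ y v w := by
        rw [hy]
      have h3 : 𝓢.deviation (Kerr.background M a) Ψ y v w =
          pullbackBilin (I := 𝓡 4) (I' := 𝓘(ℝ, E4)) Ψ 𝓢.metric.val y v w -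
            Kerr.bilin M a y v w := rfl
      rw [h1, h2, h3]
      ring
    exact ContinuousLinearMap.ext fun v ↦ ContinuousLinearMap.ext fun w ↦ (e v w).symm
  have hfun : 𝓢.deviationExtend (Kerr.background M a) Ψ = fun z ↦ G z - Kerr.bilin M a z := by
    funext z
    exact (add_sub_cancel_right (𝓢.deviationExtend (Kerr.background M a) Ψ z)
      (Kerr.bilin M a z)).symm
  have hx : (x : E4) ∈ Kerr.exterior M a := x.2
  rw [hfun]
  exact hGs.sub (Kerr.contDiffAt_bilin M a (Kerr.radius_pos_of_mem_region hx))

/-- A late-time chart on the Kerr background restricts, along `U ≤ Kerr.exterior M a`, to a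
late-time chart on the Minkowski background over `U` (same time function `x⁰`): smoothness and
the open-embedding property pass to open subdomains (DHRT arXiv:2104.08222, §1).
[cite: arXiv210408222, §1] -/
theorem isLateChart_backgroundOn_comp_inclusion {M a : ℝ} {𝒟 : Set 𝓢.carrier} {τ₀ : ℝ}
    {Ψ : (Kerr.background M a).domain → 𝓢.carrier}
    (hΨ : 𝓢.IsLateChart (Kerr.background M a) 𝒟 τ₀ Ψ) {U : Opens E4}
    (h : (Minkowski.backgroundOn U).domain ≤ (Kerr.background M a).domain) :
    𝓢.IsLateChart (Minkowski.backgroundOn U) 𝒟 τ₀ (Ψ ∘ Opens.inclusion h) where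
  contMDiff := hΨ.contMDiff.comp (contMDiff_inclusion h)
  isOpenEmbedding := by
    have hc0 : Continuous fun y : E4 ↦ y 0 := PiLp.continuous_apply 2 _ 0
    have hLK : IsOpen ((Kerr.background M a).lateRegion τ₀) :=
      isOpen_lt continuous_const (hc0.comp continuous_subtype_val)
    have hLU : IsOpen ((Minkowski.backgroundOn U).lateRegion τ₀) :=
      isOpen_lt continuous_const (hc0.comp continuous_subtype_val)
    let j : (Minkowski.backgroundOn U).lateRegion τ₀ → (Kerr.background M a).lateRegion τ₀ :=
      fun x ↦ ⟨Opens.inclusion h x.1, x.2⟩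
    have hgK : IsOpenEmbedding (fun x : (Kerr.background M a).lateRegion τ₀ ↦ (x.1.1 : E4)) :=
      (Kerr.background M a).domain.2.isOpenEmbedding_subtypeVal.comp
        hLK.isOpenEmbedding_subtypeVal
    have hgU : IsOpenEmbedding
        (fun x : (Minkowski.backgroundOn U).lateRegion τ₀ ↦ (x.1.1 : E4)) :=
      (Minkowski.backgroundOn U).domain.2.isOpenEmbedding_subtypeVal.comp
        hLU.isOpenEmbedding_subtypeVal
    have hj : IsOpenEmbedding j := IsOpenEmbedding.of_comp j hgK hgU
    exact hΨ.isOpenEmbedding.comp hj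
  image_subset := by
    rintro _ ⟨x, hx, rfl⟩
    exact hΨ.image_subset ⟨Opens.inclusion h x, hx, rfl⟩

/-- Transport of a late-time chart and its decay along an equality of reference backgrounds
(bookkeeping for `boostedKerrBackground 1 0 M a = Kerr.background M a`). [folklore] -/
theorem exists_isLateChart_of_eq {𝒟 : Set 𝓢.carrier} {k : ℕ} {τ₀ : ℝ} {B₀ : ModelBackground}
    {Ψ : B₀.domain → 𝓢.carrier} (hΨ : 𝓢.IsLateChart B₀ 𝒟 τ₀ Ψ)
    (ht : Tendsto (fun τ ↦ 𝓢.deviationCk B₀ Ψ k τ) atTop (𝓝 0)) (B : ModelBackground)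
    (hB : B = B₀) :
    ∃ Ψ' : B.domain → 𝓢.carrier, 𝓢.IsLateChart B 𝒟 τ₀ Ψ' ∧
      (∀ R, Tendsto (fun τ ↦ 𝓢.truncDeviationCk B Ψ' k R τ) atTop (𝓝 0)) ∧
      Ψ' '' B.lateRegion τ₀ = Ψ '' B₀.lateRegion τ₀ ∧
      Ψ' '' B.timeSlab τ₀ = Ψ '' B₀.timeSlab τ₀ := by
  subst hB
  exact ⟨Ψ, hΨ, fun R ↦ tendsto_of_tendsto_of_tendsto_of_le_of_le tendsto_const_nhds ht
    (fun _ ↦ zero_le) fun τ ↦ 𝓢.truncDeviationCk_le_deviationCk B Ψ k R τ, rfl, rfl⟩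

end Spacetime

/-! ### The trivial motion `(1, 0)` -/

/-- `poincareInv 1 0 = id` (O'Neill 1983, Ch. 9, p. 236). [cite: ONeill1983, Ch. 9, p. 236] -/
@[simp]
theorem poincareInv_one_zero (x : E4) : poincareInv 1 0 x = x := by
  rw [poincareInv, sub_zero]
  rfl

/-- For the trivial motion the boosted exterior is the Kerr exterior (Klainerman, §4).
[folklore] -/
theorem boostedKerrExterior_one_zero (M a : ℝ) :
    boostedKerrExterior 1 0 M a = Kerr.exterior M a := by
  ext x
  simp

/-- For the trivial motion the boosted Kerr background is the Kerr background
(Kerr–Schild 1965, Lorentz covariance of the ansatz; Klainerman, §4). [cite: KerrSchild1965] -/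
theorem boostedKerrBackground_one_zero (M a : ℝ) :
    boostedKerrBackground 1 0 M a = Kerr.background M a := by
  have h1 := boostedKerrExterior_one_zero M a
  have h2 : boostedKerrBilin 1 0 M a = Kerr.bilin M a := funext (boostedKerrBilin_one_zero M a)
  have h3 : (fun x : E4 ↦ poincareInv 1 0 x 0) = fun x ↦ x 0 :=
    funext fun x ↦ by rw [poincareInv_one_zero]
  have h4 : (fun x : E4 ↦ Kerr.radius a (poincareInv 1 0 x)) = Kerr.radius a :=
    funext fun x ↦ by rw [poincareInv_one_zero]
  unfold boostedKerrBackground Kerr.background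
  rw [h1, h2, h3, h4]


/-! ### Generic calculus: scaling, sums and slices of iterated derivatives -/

section GenericCalculus

variable {E' G : Type*} [NormedAddCommGroup E'] [NormedSpace ℝ E'] [NormedAddCommGroup G]
  [NormedSpace ℝ G]

/-- **Iterated derivatives under scaling**: for `ε ≠ 0`,
`‖D^m (z ↦ c f(ε z))(x)‖ ≤ |c| |ε|^m ‖D^m f (ε x)‖` (chain rule with the linear automorphism
`z ↦ ε z`, Mathlib's `ContinuousLinearEquiv.iteratedFDerivWithin_comp_right`). [folklore] -/
theorem norm_iteratedFDeriv_const_smul_comp_smul_le (f : E' → G) (c : ℝ) {ε : ℝ} (hε : ε ≠ 0)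
    (x : E') {m : ℕ} (hf : ContDiffAt ℝ m f (ε • x)) :
    ‖iteratedFDeriv ℝ m (fun z ↦ c • f (ε • z)) x‖ ≤
      |c| * |ε| ^ m * ‖iteratedFDeriv ℝ m f (ε • x)‖ := by
  -- scaling by `ε` as a continuous linear automorphism `e`, `e z = ε z`, `‖e‖ ≤ |ε|`
  set e : E' ≃L[ℝ] E' := (Units.mk0 ε hε) • ContinuousLinearEquiv.refl ℝ E' with he
  have he_apply : ∀ z, e z = ε • z := fun z ↦ rfl
  have hnorm : ‖(e : E' →L[ℝ] E')‖ ≤ |ε| :=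
    ContinuousLinearMap.opNorm_le_bound _ (abs_nonneg ε) fun z ↦ by
      rw [ContinuousLinearEquiv.coe_coe, he_apply, norm_smul, Real.norm_eq_abs]
  have hg : ContDiffAt ℝ m (fun z ↦ f (ε • z)) x := hf.comp x (contDiff_const_smul ε).contDiffAt
  have hcomp : iteratedFDeriv ℝ m (fun z ↦ f (ε • z)) x =
      (iteratedFDeriv ℝ m f (ε • x)).compContinuousLinearMap fun _ ↦ (e : E' →L[ℝ] E') := by
    have h := e.iteratedFDerivWithin_comp_right f uniqueDiffOn_univ (mem_univ _) m (x := x)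
    rw [Set.preimage_univ, iteratedFDerivWithin_univ, iteratedFDerivWithin_univ] at h
    exact h
  rw [iteratedFDeriv_const_smul_apply' (a := c) hg, hcomp, norm_smul, Real.norm_eq_abs, mul_assoc]
  refine mul_le_mul_of_nonneg_left ?_ (abs_nonneg c)
  refine (ContinuousMultilinearMap.norm_compContinuousLinearMap_le _ _).trans ?_
  rw [mul_comm]
  refine mul_le_mul_of_nonneg_right ?_ (norm_nonneg _)
  calc ∏ _i : Fin m, ‖(e : E' →L[ℝ] E')‖ ≤ ∏ _i : Fin m, |ε| :=
        Finset.prod_le_prod (fun _ _ ↦ norm_nonneg _) fun _ _ ↦ hnorm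
    _ = |ε| ^ m := by simp

/-- The iterated derivative of a sum of two `C^m` functions is bounded (in `‖·‖ₑ`) by the sum of
the iterated derivatives (Mathlib's `iteratedFDeriv_add_apply`). [folklore] -/
theorem enorm_iteratedFDeriv_add_le {f g : E' → G} {x : E'} {m : ℕ} (hf : ContDiffAt ℝ m f x)
    (hg : ContDiffAt ℝ m g x) :
    ‖iteratedFDeriv ℝ m (f + g) x‖ₑ ≤ ‖iteratedFDeriv ℝ m f x‖ₑ + ‖iteratedFDeriv ℝ m g x‖ₑ := by
  rw [iteratedFDeriv_add_apply hf hg]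
  exact enorm_add_le (iteratedFDeriv ℝ m f x) (iteratedFDeriv ℝ m g x)

omit [NormedSpace ℝ G] in
/-- `‖v‖ ≤ r` gives `‖v‖ₑ ≤ ENNReal.ofReal r`. [folklore] -/
theorem enorm_le_ofReal_of_norm_le {v : G} {r : ℝ} (h : ‖v‖ ≤ r) : ‖v‖ₑ ≤ ENNReal.ofReal r := by
  rw [← ofReal_norm v]
  exact ENNReal.ofReal_le_ofReal h

end GenericCalculus

/-! ### The Kerr–Schild perturbation: algebra, smoothness, scaling and decay of all derivatives -/

namespace Kerr

/-- `g_{M,a} − η = 2H ℓ ⊗ ℓ` (Kerr–Schild 1965, §2; Visser arXiv:0706.0622, (32)).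
[cite: KerrSchild1965, §2] -/
theorem ksPert_eq (M a : ℝ) (x : E4) :
    bilin M a x - Minkowski.bilin =
      (2 * scalarH M a x) • E4.tmul (nullCovector a x) (nullCovector a x) :=
  add_sub_cancel_left Minkowski.bilin _

/-- The Kerr–Schild perturbation is `C^n` wherever `r > 0` (Kerr–Schild 1965, §3).
[cite: KerrSchild1965, §3] -/
theorem contDiffAt_ksPert {M a : ℝ} {x : E4} (hx : 0 < radius a x) {n : WithTop ℕ∞} :
    ContDiffAt ℝ n (fun y ↦ bilin M a y - Minkowski.bilin) x :=
  (contDiffAt_bilin M a hx).sub contDiffAt_const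

/-! #### Joint smoothness in the rotation parameter and the point -/

/-- The Kerr–Schild radius is jointly `C^n` in `(a, x)` wherever it is positive (both square
roots of Visser arXiv:0706.0622, (35) have positive arguments). [cite: arXiv07060622, (35)] -/
theorem contDiffAt_radius₂ {p : ℝ × E4} (hp : 0 < radius p.1 p.2) {n : WithTop ℕ∞} :
    ContDiffAt ℝ n (fun q : ℝ × E4 ↦ radius q.1 q.2) p := by
  have hs : ContDiff ℝ n fun q : ℝ × E4 ↦ E4.spatialNorm q.2 ^ 2 :=
    contDiff_spatialNorm_sq.comp contDiff_snd
  have ha : ContDiff ℝ n fun q : ℝ × E4 ↦ q.1 := contDiff_fst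
  have h3 : ContDiff ℝ n fun q : ℝ × E4 ↦ q.2 3 := (contDiff_coord 3).comp contDiff_snd
  have hD : ContDiff ℝ n fun q : ℝ × E4 ↦ radiusDiscr q.1 q.2 := by
    unfold radiusDiscr
    exact ((hs.sub (ha.pow 2)).pow 2).add ((contDiff_const.mul (ha.pow 2)).mul (h3.pow 2))
  have hq : ContDiffAt ℝ n
      (fun q : ℝ × E4 ↦ ((E4.spatialNorm q.2 ^ 2 - q.1 ^ 2) + √(radiusDiscr q.1 q.2)) / 2) p :=
    ((hs.sub (ha.pow 2)).contDiffAt.add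
      (hD.contDiffAt.sqrt (radiusDiscr_pos hp).ne')).div_const 2
  have hpos : ((E4.spatialNorm p.2 ^ 2 - p.1 ^ 2) + √(radiusDiscr p.1 p.2)) / 2 ≠ 0 := by
    have h := radius_sq p.1 p.2
    have h2 : 0 < radius p.1 p.2 ^ 2 := by positivity
    rw [h] at h2
    exact h2.ne'
  exact hq.sqrt hpos

/-- `H = M r³/(r⁴ + a² z²)` is jointly `C^n` in `(a, x)` wherever `r > 0` (Visser arXiv:0706.0622,
(33)). [cite: arXiv07060622, (33)] -/
theorem contDiffAt_scalarH₂ (M : ℝ) {p : ℝ × E4} (hp : 0 < radius p.1 p.2) {n : WithTop ℕ∞} :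
    ContDiffAt ℝ n (fun q : ℝ × E4 ↦ scalarH M q.1 q.2) p := by
  unfold scalarH
  have hr := contDiffAt_radius₂ hp (n := n)
  have ha : ContDiffAt ℝ n (fun q : ℝ × E4 ↦ q.1) p := contDiff_fst.contDiffAt
  have h3 : ContDiffAt ℝ n (fun q : ℝ × E4 ↦ q.2 3) p :=
    ((contDiff_coord 3).comp contDiff_snd).contDiffAt
  refine (contDiffAt_const.mul (hr.pow 3)).div ((hr.pow 4).add ((ha.pow 2).mul (h3.pow 2))) ?_
  positivity

/-- The components `ℓ_μ` are jointly `C^n` in `(a, x)` wherever `r > 0` (Visser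
arXiv:0706.0622, (34)). [cite: arXiv07060622, (34)] -/
theorem contDiffAt_nullCovectorFun₂ {p : ℝ × E4} (hp : 0 < radius p.1 p.2) {n : WithTop ℕ∞}
    (μ : Fin 4) : ContDiffAt ℝ n (fun q : ℝ × E4 ↦ nullCovectorFun q.1 q.2 μ) p := by
  have hr := contDiffAt_radius₂ hp (n := n)
  have ha : ContDiffAt ℝ n (fun q : ℝ × E4 ↦ q.1) p := contDiff_fst.contDiffAt
  have h1 : ContDiffAt ℝ n (fun q : ℝ × E4 ↦ q.2 1) p :=
    ((contDiff_coord 1).comp contDiff_snd).contDiffAt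
  have h2 : ContDiffAt ℝ n (fun q : ℝ × E4 ↦ q.2 2) p :=
    ((contDiff_coord 2).comp contDiff_snd).contDiffAt
  have h3 : ContDiffAt ℝ n (fun q : ℝ × E4 ↦ q.2 3) p :=
    ((contDiff_coord 3).comp contDiff_snd).contDiffAt
  have hra : radius p.1 p.2 ^ 2 + p.1 ^ 2 ≠ 0 := by positivity
  fin_cases μ
  · simp only [nullCovectorFun, Fin.zero_eta, Fin.isValue, Matrix.cons_val_zero]
    exact contDiffAt_const
  · simp only [nullCovectorFun, Fin.mk_one, Fin.isValue, Matrix.cons_val_one, Matrix.cons_val_zero]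
    exact ((hr.mul h1).add (ha.mul h2)).div ((hr.pow 2).add (ha.pow 2)) hra
  · simp only [nullCovectorFun, Fin.reduceFinMk, Fin.isValue, Matrix.cons_val]
    exact ((hr.mul h2).sub (ha.mul h1)).div ((hr.pow 2).add (ha.pow 2)) hra
  · simp only [nullCovectorFun, Fin.reduceFinMk, Fin.isValue, Matrix.cons_val]
    exact h3.div hr hp.ne'

/-- The null covector is jointly `C^n` in `(a, x)` wherever `r > 0` (Kerr–Schild 1965, §3).
[cite: KerrSchild1965, §3] -/
theorem contDiffAt_nullCovector₂ {p : ℝ × E4} (hp : 0 < radius p.1 p.2) {n : WithTop ℕ∞} :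
    ContDiffAt ℝ n (fun q : ℝ × E4 ↦ nullCovector q.1 q.2) p := by
  have : (fun q : ℝ × E4 ↦ nullCovector q.1 q.2) =
      fun q ↦ ∑ μ, nullCovectorFun q.1 q.2 μ • E4.dx μ := rfl
  rw [this]
  exact ContDiffAt.sum fun μ _ ↦ (contDiffAt_nullCovectorFun₂ hp μ).smul contDiffAt_const

/-- **The Kerr–Schild perturbation `(a, x) ↦ g_{1,a}(x) − η` is jointly `C^n` wherever `r > 0`.**
Kerr–Schild 1965, §3; Visser arXiv:0706.0622, (32)–(35). [cite: KerrSchild1965, §3] -/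
theorem contDiffAt_ksPert₂ {p : ℝ × E4} (hp : 0 < radius p.1 p.2) {n : WithTop ℕ∞} :
    ContDiffAt ℝ n (fun q : ℝ × E4 ↦ bilin 1 q.1 q.2 - Minkowski.bilin) p := by
  have hl := contDiffAt_nullCovector₂ hp (n := n)
  have hH := contDiffAt_scalarH₂ 1 hp (n := n)
  have : (fun q : ℝ × E4 ↦ bilin 1 q.1 q.2 - Minkowski.bilin) = fun q ↦
      E4.tmul ((2 * scalarH 1 q.1 q.2) • nullCovector q.1 q.2) (nullCovector q.1 q.2) := by
    funext q
    rw [ksPert_eq, tmul_smul_left]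
  rw [this]
  exact ((contDiffAt_const.mul hH).smul hl).smulRight hl

/-! #### Scaling: `g_{M,a} − η` at `x` equals `ε M (g_{1,εa} − η)` at `ε x` -/

/-- `‖(c x)⃗‖ = |c| ‖x⃗‖`. [folklore] -/
theorem spatialNorm_smul (c : ℝ) (x : E4) : E4.spatialNorm (c • x) = |c| * E4.spatialNorm x := by
  simp [E4.spatialNorm, norm_smul]

/-- **Scaling of the Kerr–Schild radius**: `r_{εa}(ε x) = ε r_a(x)` for `ε > 0` (the defining
quartic of Visser arXiv:0706.0622, (35) is homogeneous). [cite: arXiv07060622, (35)] -/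
theorem radius_smul {ε : ℝ} (hε : 0 < ε) (a : ℝ) (x : E4) :
    radius (ε * a) (ε • x) = ε * radius a x := by
  have hS : E4.spatialNorm (ε • x) ^ 2 = ε ^ 2 * E4.spatialNorm x ^ 2 := by
    rw [spatialNorm_smul, abs_of_pos hε]
    ring
  have h3 : (ε • x) 3 = ε * x 3 := by simp
  set S := E4.spatialNorm x ^ 2 with hSdef
  set D := (S - a ^ 2) ^ 2 + 4 * a ^ 2 * x 3 ^ 2 with hDdef
  have hD0 : 0 ≤ D := by positivity
  have hinner : 0 ≤ (S - a ^ 2 + √D) / 2 := by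
    have h := radius_sq a x
    have h2 : 0 ≤ radius a x ^ 2 := sq_nonneg _
    rw [h] at h2
    exact h2
  unfold radius
  rw [hS, h3, show (ε ^ 2 * S - (ε * a) ^ 2) ^ 2 + 4 * (ε * a) ^ 2 * (ε * x 3) ^ 2 =
    (ε ^ 2) ^ 2 * D by rw [hDdef]; ring, Real.sqrt_mul (by positivity) D,
    Real.sqrt_sq (by positivity), show (ε ^ 2 * S - (ε * a) ^ 2 + ε ^ 2 * √D) / 2 =
    ε ^ 2 * ((S - a ^ 2 + √D) / 2) by ring, Real.sqrt_mul (by positivity), Real.sqrt_sq hε.le]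

/-- **Scaling of `H`**: `ε M · H_{1,εa}(ε x) = H_{M,a}(x)` (Visser arXiv:0706.0622, (33)).
[cite: arXiv07060622, (33)] -/
theorem scalarH_smul {ε : ℝ} (hε : 0 < ε) (M a : ℝ) (x : E4) :
    (ε * M) * scalarH 1 (ε * a) (ε • x) = scalarH M a x := by
  unfold scalarH
  rw [radius_smul hε, show (ε • x) 3 = ε * x 3 by simp]
  set r := radius a x
  have hfac : (ε * r) ^ 4 + (ε * a) ^ 2 * (ε * x 3) ^ 2 = ε ^ 4 * (r ^ 4 + a ^ 2 * x 3 ^ 2) := by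
    ring
  rcases eq_or_ne (r ^ 4 + a ^ 2 * x 3 ^ 2) 0 with h0 | h0
  · rw [hfac, h0, mul_zero, div_zero, div_zero, mul_zero]
  · have hden : (ε * r) ^ 4 + (ε * a) ^ 2 * (ε * x 3) ^ 2 ≠ 0 := by
      rw [hfac]
      exact mul_ne_zero (by positivity) h0
    rw [← mul_div_assoc, div_eq_div_iff hden h0]
    ring

/-- **Scaling of `ℓ`**: `ℓ_{εa}(ε x) = ℓ_a(x)` componentwise (Visser arXiv:0706.0622, (34): the
components are homogeneous of degree `0`). [cite: arXiv07060622, (34)] -/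
theorem nullCovectorFun_smul {ε : ℝ} (hε : 0 < ε) (a : ℝ) (x : E4) :
    nullCovectorFun (ε * a) (ε • x) = nullCovectorFun a x := by
  have hr := radius_smul hε a x
  have h1 : (ε • x) 1 = ε * x 1 := by simp
  have h2 : (ε • x) 2 = ε * x 2 := by simp
  have h3 : (ε • x) 3 = ε * x 3 := by simp
  have hε0 : ε ≠ 0 := hε.ne'
  have hε2 : ε ^ 2 ≠ 0 := pow_ne_zero 2 hε0
  set r := radius a x
  have e1 : (ε * r * (ε * x 1) + ε * a * (ε * x 2)) / ((ε * r) ^ 2 + (ε * a) ^ 2) =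
      (r * x 1 + a * x 2) / (r ^ 2 + a ^ 2) := by
    rw [show ε * r * (ε * x 1) + ε * a * (ε * x 2) = ε ^ 2 * (r * x 1 + a * x 2) by ring,
      show (ε * r) ^ 2 + (ε * a) ^ 2 = ε ^ 2 * (r ^ 2 + a ^ 2) by ring, mul_div_mul_left _ _ hε2]
  have e2 : (ε * r * (ε * x 2) - ε * a * (ε * x 1)) / ((ε * r) ^ 2 + (ε * a) ^ 2) =
      (r * x 2 - a * x 1) / (r ^ 2 + a ^ 2) := by
    rw [show ε * r * (ε * x 2) - ε * a * (ε * x 1) = ε ^ 2 * (r * x 2 - a * x 1) by ring,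
      show (ε * r) ^ 2 + (ε * a) ^ 2 = ε ^ 2 * (r ^ 2 + a ^ 2) by ring, mul_div_mul_left _ _ hε2]
  have e3 : ε * x 3 / (ε * r) = x 3 / r := mul_div_mul_left _ _ hε0
  unfold nullCovectorFun
  rw [hr, h1, h2, h3, e1, e2, e3]

/-- Scaling of the null covector: `ℓ_{εa}(ε x) = ℓ_a(x)` (Visser arXiv:0706.0622, (34)).
[cite: arXiv07060622, (34)] -/
theorem nullCovector_smul {ε : ℝ} (hε : 0 < ε) (a : ℝ) (x : E4) :
    nullCovector (ε * a) (ε • x) = nullCovector a x := by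
  unfold nullCovector
  rw [nullCovectorFun_smul hε]

/-- **Scaling law of the Kerr–Schild perturbation**: `(g_{M,a} − η)(x) = ε M (g_{1,εa} − η)(ε x)`
for `ε > 0` (homogeneity of the Kerr–Schild ansatz; Kerr–Schild 1965, §2; Visser
arXiv:0706.0622, (32)–(35)). [cite: KerrSchild1965, §2] -/
theorem ksPert_smul {ε : ℝ} (hε : 0 < ε) (M a : ℝ) (x : E4) :
    bilin M a x - Minkowski.bilin = (ε * M) • (bilin 1 (ε * a) (ε • x) - Minkowski.bilin) := by
  rw [ksPert_eq, ksPert_eq, nullCovector_smul hε, smul_smul]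
  rw [← scalarH_smul hε M a x]
  congr 1
  ring

/-! #### Dependence on the spatial coordinates only -/

/-- The Kerr–Schild perturbation depends on the point only through its spatial part (the
Kerr–Schild form is stationary: Kerr–Schild 1965, §2). [cite: KerrSchild1965, §2] -/
theorem ksPert_eq_of_spatial_eq (M a : ℝ) {x y : E4} (h : E4.spatial x = E4.spatial y) :
    bilin M a x - Minkowski.bilin = bilin M a y - Minkowski.bilin := by
  have h1 : x 1 = y 1 := by simpa using congrArg (fun v : E3 ↦ v 0) h
  have h2 : x 2 = y 2 := by simpa using congrArg (fun v : E3 ↦ v 1) h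
  have h3 : x 3 = y 3 := by simpa using congrArg (fun v : E3 ↦ v 2) h
  have hn : E4.spatialNorm x = E4.spatialNorm y := by rw [E4.spatialNorm, E4.spatialNorm, h]
  have hr : radius a x = radius a y := by
    unfold radius
    rw [hn, h3]
  have hH : scalarH M a x = scalarH M a y := by
    unfold scalarH
    rw [hr, h3]
  have hl : nullCovectorFun a x = nullCovectorFun a y := by
    unfold nullCovectorFun
    rw [hr, h1, h2, h3]
  have hl' : nullCovector a x = nullCovector a y := by
    unfold nullCovector
    rw [hl]
  rw [ksPert_eq, ksPert_eq, hH, hl']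

/-- The Kerr–Schild radius depends on the point only through its spatial part
(Visser arXiv:0706.0622, (35)). [cite: arXiv07060622, (35)] -/
theorem radius_eq_of_spatial_eq (a : ℝ) {x y : E4} (h : E4.spatial x = E4.spatial y) :
    radius a x = radius a y := by
  have h3 : x 3 = y 3 := by simpa using congrArg (fun v : E3 ↦ v 2) h
  have hn : E4.spatialNorm x = E4.spatialNorm y := by rw [E4.spatialNorm, E4.spatialNorm, h]
  unfold radius
  rw [hn, h3]

/-- Hence all iterated derivatives of the perturbation agree at points with the same spatial part
(translation invariance of `iteratedFDeriv` in time; Kerr–Schild 1965, §2). [cite: KerrSchild1965, §2] -/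
theorem iteratedFDeriv_ksPert_eq_of_spatial_eq (M a : ℝ) (m : ℕ) {x y : E4}
    (h : E4.spatial x = E4.spatial y) :
    iteratedFDeriv ℝ m (fun y ↦ bilin M a y - Minkowski.bilin) x =
      iteratedFDeriv ℝ m (fun y ↦ bilin M a y - Minkowski.bilin) y := by
  have hfun : (fun z ↦ bilin M a (z + (y - x)) - Minkowski.bilin) =
      fun y ↦ bilin M a y - Minkowski.bilin := by
    funext z
    exact ksPert_eq_of_spatial_eq M a (by rw [map_add, map_sub, h, sub_self, add_zero])
  have key : iteratedFDeriv ℝ m (fun z ↦ bilin M a (z + (y - x)) - Minkowski.bilin) x =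
      iteratedFDeriv ℝ m (fun y ↦ bilin M a y - Minkowski.bilin) (x + (y - x)) :=
    iteratedFDeriv_comp_add_right (𝕜 := ℝ) (f := fun y ↦ bilin M a y - Minkowski.bilin) m (y - x) x
  rw [hfun, add_sub_cancel] at key
  exact key

/-! #### Bounds: `r ≤ ‖x⃗‖`, positivity of `r` far out -/

/-- `r > 0` as soon as `‖x⃗‖ > |a|` (then `r² ≥ (‖x⃗‖² − a²)/2 > 0`; Visser arXiv:0706.0622,
(35)). [cite: arXiv07060622, (35)] -/
theorem radius_pos_of_abs_lt {a : ℝ} {x : E4} (h : |a| < E4.spatialNorm x) : 0 < radius a x := by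
  have hs : a ^ 2 < E4.spatialNorm x ^ 2 := sq_lt_sq' (abs_lt.mp h).1 (abs_lt.mp h).2
  have h2 : 0 < radius a x ^ 2 := by
    rw [radius_sq]
    have := Real.sqrt_nonneg ((E4.spatialNorm x ^ 2 - a ^ 2) ^ 2 + 4 * a ^ 2 * x 3 ^ 2)
    linarith
  rcases (radius_nonneg a x).eq_or_lt with h0 | h0
  · rw [← h0] at h2
    norm_num at h2
  · exact h0

/-! #### A local slice estimate for iterated derivatives on `ℝ × F` -/

/-- **Norm of the slice of a `C^n` map on an open set of `ℝ × F`**: for `g` `C^n` on the open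
set `O ∋ (θ₀, ξ₀)` and `i ≤ n`, `‖D^i (g(θ₀, ·))(ξ₀)‖ ≤ ‖D^i g(θ₀, ξ₀)‖` (the slice is the
composition with the isometric embedding `inr`, of norm `≤ 1`; Dieudonné, *Foundations of
Modern Analysis* (1960), (8.12.8)). [folklore] -/
theorem norm_iteratedFDeriv_slice_le {F G : Type*} [NormedAddCommGroup F] [NormedSpace ℝ F]
    [NormedAddCommGroup G] [NormedSpace ℝ G] {g : ℝ × F → G} {O : Set (ℝ × F)} (hO : IsOpen O)
    {n : WithTop ℕ∞} (hg : ContDiffOn ℝ n g O) {θ₀ : ℝ} {ξ₀ : F} (hp : (θ₀, ξ₀) ∈ O) {i : ℕ}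
    (hi : (i : WithTop ℕ∞) ≤ n) :
    ‖iteratedFDeriv ℝ i (fun ξ ↦ g (θ₀, ξ)) ξ₀‖ ≤ ‖iteratedFDeriv ℝ i g (θ₀, ξ₀)‖ := by
  set U₀ : Set (ℝ × F) := (fun q : ℝ × F ↦ ((θ₀, (0 : F)) : ℝ × F) + q) ⁻¹' O with hU₀
  have hU₀o : IsOpen U₀ := hO.preimage (by fun_prop)
  set h : ℝ × F → G := fun q ↦ g (((θ₀, (0 : F)) : ℝ × F) + q) with hh
  have hhs : ContDiffOn ℝ n h U₀ := hg.comp (contDiffOn_const.add contDiffOn_id) fun q hq ↦ hq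
  set V : Set F := (ContinuousLinearMap.inr ℝ ℝ F) ⁻¹' U₀ with hV
  have hVo : IsOpen V := hU₀o.preimage (ContinuousLinearMap.inr ℝ ℝ F).continuous
  have hmem : ContinuousLinearMap.inr ℝ ℝ F ξ₀ ∈ U₀ := by
    simp [hU₀, hp]
  have hξV : ξ₀ ∈ V := hmem
  have key := (ContinuousLinearMap.inr ℝ ℝ F).iteratedFDerivWithin_comp_right hhs hU₀o.uniqueDiffOn
    hVo.uniqueDiffOn hmem hi
  rw [iteratedFDerivWithin_of_isOpen i hVo hξV, iteratedFDerivWithin_of_isOpen i hU₀o hmem] at key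
  have hfun : (h ∘ ContinuousLinearMap.inr ℝ ℝ F) = fun ξ ↦ g (θ₀, ξ) := by
    funext ξ
    simp [hh]
  rw [hfun] at key
  have hpt : iteratedFDeriv ℝ i h (ContinuousLinearMap.inr ℝ ℝ F ξ₀) = iteratedFDeriv ℝ i g (θ₀, ξ₀) := by
    rw [hh, iteratedFDeriv_comp_add_left]
    simp
  rw [key, hpt]
  refine (ContinuousMultilinearMap.norm_compContinuousLinearMap_le _ _).trans ?_
  have h1 : ∏ _i : Fin i, ‖ContinuousLinearMap.inr ℝ ℝ F‖ ≤ 1 :=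
    Finset.prod_le_one (fun _ _ ↦ norm_nonneg _) fun _ _ ↦ ContinuousLinearMap.norm_inr_le_one ℝ ℝ F
  calc ‖iteratedFDeriv ℝ i g (θ₀, ξ₀)‖ * ∏ _i : Fin i, ‖ContinuousLinearMap.inr ℝ ℝ F‖
      ≤ ‖iteratedFDeriv ℝ i g (θ₀, ξ₀)‖ * 1 := mul_le_mul_of_nonneg_left h1 (norm_nonneg _)
    _ = _ := mul_one _

/-! #### Uniform bounds on the unit shell, and decay of all derivatives -/

/-- **Uniform bound on the unit shell.** For every order `m` there is `B` with
`‖D^m (g_{1,a'} − η)(y)‖ ≤ B` for all `|a'| ≤ 1/2` and all `y` with `y⁰ = 0`, `‖y⃗‖ = 1`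
(continuity of `D^m` of the jointly smooth perturbation on the compact set
`[−1/2, 1/2] × {y⁰ = 0, ‖y⃗‖ = 1} ⊆ {r > 0}`). [cite: KerrSchild1965, §3] -/
theorem exists_bound_iteratedFDeriv_ksPert_one (m : ℕ) :
    ∃ B : ℝ, ∀ a' : ℝ, |a'| ≤ 1 / 2 → ∀ y : E4, y 0 = 0 → E4.spatialNorm y = 1 →
      (‖iteratedFDeriv ℝ m (fun y ↦ bilin 1 a' y - Minkowski.bilin) y‖ : ℝ) ≤ B := by
  set O : Set (ℝ × E4) := {p | 0 < radius p.1 p.2} with hO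
  have hOo : IsOpen O := by
    refine isOpen_lt continuous_const ?_
    unfold radius E4.spatialNorm
    fun_prop
  have hcd : ContDiffOn ℝ ∞ (fun q : ℝ × E4 ↦ bilin 1 q.1 q.2 - Minkowski.bilin) O :=
    fun p hp ↦ (contDiffAt_ksPert₂ hp).contDiffWithinAt
  have hcont : ContinuousOn
      (iteratedFDeriv ℝ m (fun q : ℝ × E4 ↦ bilin 1 q.1 q.2 - Minkowski.bilin)) O := by
    have h1 := hcd.continuousOn_iteratedFDerivWithin (m := m) (by exact_mod_cast le_top)
      hOo.uniqueDiffOn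
    exact h1.congr fun p hp ↦ (iteratedFDerivWithin_of_isOpen m hOo hp).symm
  set K : Set (ℝ × E4) :=
    Set.Icc (-(1 / 2 : ℝ)) (1 / 2) ×ˢ {y : E4 | y 0 = 0 ∧ E4.spatialNorm y = 1} with hK
  have hsn : Continuous E4.spatialNorm := continuous_norm.comp E4.spatial.continuous
  have hKc : IsCompact K := by
    refine isCompact_Icc.prod ?_
    have hclosed : IsClosed {y : E4 | y 0 = 0 ∧ E4.spatialNorm y = 1} :=
      (isClosed_eq (PiLp.continuous_apply 2 _ 0) continuous_const).inter
        (isClosed_eq hsn continuous_const)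
    refine Metric.isCompact_of_isClosed_isBounded hclosed ?_
    refine (Metric.isBounded_closedBall (x := (0 : E4)) (r := 1)).subset ?_
    intro y hy
    rw [Metric.mem_closedBall, dist_zero_right]
    have hsq : ‖y‖ ^ 2 = 1 := by
      have h' := E4.spatialNorm_sq y
      rw [hy.2] at h'
      rw [EuclideanSpace.real_norm_sq_eq, Fin.sum_univ_four, hy.1]
      nlinarith [h']
    nlinarith [norm_nonneg y]
  have hKO : K ⊆ O := by
    rintro ⟨a', y⟩ ⟨ha', hy⟩
    change 0 < radius a' y
    apply radius_pos_of_abs_lt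
    rw [hy.2, abs_lt]
    constructor <;> linarith [ha'.1, ha'.2]
  obtain ⟨C, hC⟩ := hKc.exists_bound_of_continuousOn (hcont.mono hKO)
  refine ⟨C, fun a' ha' y hy0 hy1 ↦ ?_⟩
  have hmem : (a', y) ∈ K := ⟨⟨by linarith [(abs_le.mp ha').1], (abs_le.mp ha').2⟩, hy0, hy1⟩
  have hslice := norm_iteratedFDeriv_slice_le hOo hcd (hKO hmem) (i := m) (by exact_mod_cast le_top)
  exact hslice.trans (hC _ hmem)

-- the algebraic and the operator-norm instance paths on `E4 →L[ℝ] E4 →L[ℝ] ℝ` unify slowly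
set_option synthInstance.maxHeartbeats 200000 in
/-- **Decay of all derivatives of the Kerr–Schild perturbation at spatial infinity**:
for every order `m` there are `C` and `R > 0` with `‖D^m (g_{M,a} − η)(x)‖ ≤ C / r(x)` whenever
`r(x) ≥ R` (in fact `O(r^{-1-m})`; here only `O(r⁻¹)` is recorded). Proof by scaling: with
`ε = 1/‖x⃗‖`, `(g_{M,a} − η) = ε M (g_{1,εa} − η) ∘ (ε ·)`, so
`D^m (g_{M,a} − η)(x) = ε^{m+1} M D^m(g_{1,εa} − η)(εx) ∘ (ε id)^{⊗ m}`, and the unit-shell bound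
applies at `εx` (after a time translation). Kerr–Schild 1965, §2–§3 (asymptotic flatness of
the Kerr–Schild form). [cite: KerrSchild1965, §3] -/
theorem norm_iteratedFDeriv_ksPert_le (M a : ℝ) (m : ℕ) :
    ∃ C R : ℝ, 0 < R ∧ ∀ x : E4, R ≤ radius a x →
      (‖iteratedFDeriv ℝ m (fun y ↦ bilin M a y - Minkowski.bilin) x‖ : ℝ) ≤ C / radius a x := by
  obtain ⟨B, hB⟩ := exists_bound_iteratedFDeriv_ksPert_one m
  refine ⟨|M| * max B 0, max 1 (2 * |a|), lt_max_of_lt_left one_pos, fun x hx ↦ ?_⟩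
  set s := E4.spatialNorm x with hs
  have hr1 : 1 ≤ radius a x := (le_max_left _ _).trans hx
  have hr0 : 0 < radius a x := one_pos.trans_le hr1
  have hrs : radius a x ≤ s := radius_le_spatialNorm a x
  have hs1 : 1 ≤ s := hr1.trans hrs
  have hs0 : 0 < s := one_pos.trans_le hs1
  have hsa : 2 * |a| ≤ s := (le_max_right _ _).trans (hx.trans hrs)
  set ε := s⁻¹ with hε
  have hε0 : 0 < ε := inv_pos.mpr hs0
  have hε1 : ε ≤ 1 := inv_le_one_of_one_le₀ hs1
  -- zero the time coordinate
  set x' : E4 := x - x 0 • E4.basisVector 0 with hx'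
  have hsp : E4.spatial x = E4.spatial x' := by
    have h0 : E4.spatial (E4.basisVector 0) = 0 := by
      ext i
      simp [E4.spatial_apply]
    rw [hx', map_sub, map_smul, h0, smul_zero, sub_zero]
  have hder := iteratedFDeriv_ksPert_eq_of_spatial_eq M a m hsp
  have hrx' : radius a x' = radius a x := (radius_eq_of_spatial_eq a hsp).symm
  have hsx' : E4.spatialNorm x' = s := by rw [hs, E4.spatialNorm, E4.spatialNorm, hsp]
  -- the rescaled point on the unit shell
  set y : E4 := ε • x' with hy
  have hy0 : y 0 = 0 := by simp [hy, hx']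
  have hy1 : E4.spatialNorm y = 1 := by
    rw [hy, spatialNorm_smul, abs_of_pos hε0, hsx', hε, inv_mul_cancel₀ hs0.ne']
  have ha' : |ε * a| ≤ 1 / 2 := by
    rw [abs_mul, abs_of_pos hε0, hε]
    rw [inv_mul_le_iff₀ hs0]
    linarith
  have hry : 0 < radius (ε * a) y := by
    rw [hy, radius_smul hε0, hrx']
    exact mul_pos hε0 hr0
  -- scaling of the iterated derivative
  have hfun : (fun y ↦ bilin M a y - Minkowski.bilin) =
      fun z ↦ (ε * M) • (bilin 1 (ε * a) (ε • z) - Minkowski.bilin) :=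
    funext fun z ↦ ksPert_smul hε0 M a z
  have hB0 : 0 ≤ max B 0 := le_max_right _ _
  have hkey := norm_iteratedFDeriv_const_smul_comp_smul_le
    (fun y ↦ bilin 1 (ε * a) y - Minkowski.bilin) (ε * M) hε0.ne' x' (m := m)
    (contDiffAt_ksPert (M := 1) hry)
  have hεm : |ε| ^ m ≤ 1 := pow_le_one₀ (abs_nonneg ε) (by rwa [abs_of_pos hε0])
  calc (‖iteratedFDeriv ℝ m (fun y ↦ bilin M a y - Minkowski.bilin) x‖ : ℝ)
        = (‖iteratedFDeriv ℝ m (fun y ↦ bilin M a y - Minkowski.bilin) x'‖ : ℝ) := by rw [hder]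
    _ = (‖iteratedFDeriv ℝ m
          (fun z ↦ (ε * M) • (bilin 1 (ε * a) (ε • z) - Minkowski.bilin)) x'‖ : ℝ) := by
        rw [← hfun]
    _ ≤ |ε * M| * |ε| ^ m *
          (‖iteratedFDeriv ℝ m (fun y ↦ bilin 1 (ε * a) y - Minkowski.bilin) y‖ : ℝ) := hkey
    _ ≤ |ε * M| * 1 * max B 0 := by
        gcongr
        exact (hB _ ha' y hy0 hy1).trans (le_max_left _ _)
    _ = ε * (|M| * max B 0) := by
        rw [abs_mul, abs_of_pos hε0]
        ring
    _ ≤ (radius a x)⁻¹ * (|M| * max B 0) :=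
        mul_le_mul_of_nonneg_right (inv_anti₀ hr0 hrs) (by positivity)
    _ = |M| * max B 0 / radius a x := by rw [div_eq_inv_mul]

end Kerr

/-! ### Convergence of the restricted chart to Minkowski space on the far region -/

namespace Spacetime

variable (𝓢 : Spacetime.{u} 4)

-- the algebraic and the operator-norm instance paths on `E4 →L[ℝ] E4 →L[ℝ] ℝ` unify slowly
set_option synthInstance.maxHeartbeats 200000 in
/-- **The radiation zone converges to Minkowski space.** If `Ψ` is a smooth Kerr chart whose
`Cᵏ` deviation from `g_{M,a}` on the slabs `{t* = τ}` tends to `0`, and `U ⊆ Kerr.exterior M a`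
is an open set whose slice at time `τ` lies in `{r > ρ(τ)}` with `ρ(τ) → ∞`, then the `Cᵏ`
deviation of `Ψ|_U` from `η` on the slabs of `U` tends to `0`:
`Ψ^* g − η = (Ψ^* g − g_{M,a}) + (g_{M,a} − η)` and `‖D^m (g_{M,a} − η)‖ ≤ C / r ≤ C / ρ(τ)`
there (DHRT arXiv:2104.08222, §1, with the asymptotic flatness of the Kerr–Schild form,
Kerr–Schild 1965, §3). [cite: arXiv210408222, §1] -/
theorem tendsto_deviationCk_backgroundOn {M a : ℝ} {k : ℕ}
    {Ψ : (Kerr.background M a).domain → 𝓢.carrier} (hΨ : ContMDiff 𝓘(ℝ, E4) (𝓡 4) ∞ Ψ)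
    (ht : Tendsto (fun τ ↦ 𝓢.deviationCk (Kerr.background M a) Ψ k τ) atTop (𝓝 0))
    {ρ : ℝ → ℝ} (hρ : Tendsto ρ atTop atTop) {U : Opens E4}
    (hU : ∀ z ∈ U, ρ (z 0) < Kerr.radius a z)
    (h : (Minkowski.backgroundOn U).domain ≤ (Kerr.background M a).domain) :
    Tendsto (fun τ ↦ 𝓢.deviationCk (Minkowski.backgroundOn U) (Ψ ∘ Opens.inclusion h) k τ)
      atTop (𝓝 0) := by
  have hdec := fun m ↦ Kerr.norm_iteratedFDeriv_ksPert_le M a m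
  choose C R hR hCR using hdec
  set Cmax : ℝ := ∑ m ∈ Finset.range (k + 1), |C m| with hCmax
  set Rmax : ℝ := ∑ m ∈ Finset.range (k + 1), R m with hRmax
  have hCm : ∀ m ≤ k, |C m| ≤ Cmax := fun m hm ↦
    Finset.single_le_sum (f := fun m ↦ |C m|) (fun _ _ ↦ abs_nonneg _)
      (Finset.mem_range.mpr (Nat.lt_succ_of_le hm))
  have hRm : ∀ m ≤ k, R m ≤ Rmax := fun m hm ↦
    Finset.single_le_sum (f := R) (fun m _ ↦ (hR m).le)
      (Finset.mem_range.mpr (Nat.lt_succ_of_le hm))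
  have hRmax0 : 0 < Rmax := (hR 0).trans_le (hRm 0 (Nat.zero_le k))
  have hCmax0 : 0 ≤ Cmax := Finset.sum_nonneg fun _ _ ↦ abs_nonneg _
  have hbound : ∀ τ, Rmax ≤ ρ τ →
      𝓢.deviationCk (Minkowski.backgroundOn U) (Ψ ∘ Opens.inclusion h) k τ ≤
        𝓢.deviationCk (Kerr.background M a) Ψ k τ + ENNReal.ofReal (Cmax / ρ τ) := by
    intro τ hτ
    refine iSup₂_le fun m hm ↦ iSup₂_le fun z hz ↦ ?_
    obtain ⟨x, hx, rfl⟩ := hz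
    have hxU : (x : E4) ∈ U := x.2
    have hx0 : (x : E4) 0 = τ := hx
    have hrad : ρ τ < Kerr.radius a x := hx0 ▸ hU x hxU
    have hρpos : 0 < ρ τ := hRmax0.trans_le hτ
    have hr0 : 0 < Kerr.radius a x := hρpos.trans hrad
    have h1 : ContDiffAt ℝ m (𝓢.deviationExtend (Kerr.background M a) Ψ) x :=
      (𝓢.contDiffAt_deviationExtend_kerr hΨ (Opens.inclusion h x)).of_le (by exact_mod_cast le_top)
    have h2 : ContDiffAt ℝ m (fun y ↦ Kerr.bilin M a y - Minkowski.bilin) x :=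
      Kerr.contDiffAt_ksPert hr0
    have hev := 𝓢.deviationExtend_backgroundOn_eventuallyEq h hΨ hxU
    rw [(hev.iteratedFDeriv ℝ m).eq_of_nhds]
    change ‖iteratedFDeriv ℝ m (𝓢.deviationExtend (Kerr.background M a) Ψ +
      fun y ↦ Kerr.bilin M a y - Minkowski.bilin) x‖ₑ ≤ _
    have hmem : (x : E4) ∈ Subtype.val '' (Kerr.background M a).timeSlab τ :=
      ⟨Opens.inclusion h x, hx0, rfl⟩
    refine (enorm_iteratedFDeriv_add_le h1 h2).trans (add_le_add ?_ ?_)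
    · exact enorm_iteratedFDeriv_le_supCkENorm hm hmem _
    · refine enorm_le_ofReal_of_norm_le ?_
      have hRle : R m ≤ Kerr.radius a x := ((hRm m hm).trans hτ).trans hrad.le
      calc (‖iteratedFDeriv ℝ m (fun y ↦ Kerr.bilin M a y - Minkowski.bilin) x‖ : ℝ)
          ≤ C m / Kerr.radius a x := hCR m x hRle
        _ ≤ Cmax / Kerr.radius a x :=
          div_le_div_of_nonneg_right ((le_abs_self _).trans (hCm m hm)) hr0.le
        _ ≤ Cmax / ρ τ := div_le_div_of_nonneg_left hCmax0 hρpos hrad.le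
  have hlim : Tendsto (fun τ ↦ 𝓢.deviationCk (Kerr.background M a) Ψ k τ +
      ENNReal.ofReal (Cmax / ρ τ)) atTop (𝓝 0) := by
    have h2 : Tendsto (fun τ ↦ Cmax / ρ τ) atTop (𝓝 0) := tendsto_const_nhds.div_atTop hρ
    simpa using ht.add (ENNReal.tendsto_ofReal h2)
  refine tendsto_of_tendsto_of_tendsto_of_le_of_le' tendsto_const_nhds hlim
    (Eventually.of_forall fun _ ↦ zero_le) ?_
  filter_upwards [hρ.eventually_ge_atTop Rmax] with τ hτ
  exact hbound τ hτ

end Spacetime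

/-! ### The discharge -/

/-- **DISCHARGE of `nonempty_finalStateDecomposition_of_convergesToKerr`** (sanity `N = 1` of
the hypothesis structure `FinalStateDecomposition`): convergence to Kerr `(M, a)` with `0 < M`,
`|a| ≤ M` in `𝒟` yields a one-black-hole decomposition — motion `(1, 0)` (the boosted background
for `(1, 0)` *is* the Kerr background, `boostedKerrBackground_one_zero`), hole chart the Kerr
chart `Ψ` (truncated convergence from full convergence, separation vacuous for one hole),
excision `ρ(t) = max(r₊, 0) + 1 + √t` (sublinear, `ρ(t)/t → 0`), flat domain
`U = {x⁰ > τ₀, r > ρ(x⁰)} ⊆ Kerr.exterior M a` with flat chart `Ψ|_U`, whose `Cᵏ` deviation from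
`η` tends to `0` by `tendsto_deviationCk_backgroundOn` (`Ψ^*g − η = (Ψ^*g − g_{M,a}) + (g_{M,a} − η)`
and the decay of all derivatives of the Kerr–Schild term, `Kerr.norm_iteratedFDeriv_ksPert_le`),
and the covering clause is `IsLateEmbedding.diff_subset_causalPast` with monotonicity of `J⁻`.
DHRT arXiv:2104.08222, §1. [cite: arXiv210408222, §1] -/
theorem nonempty_finalStateDecomposition_of_convergesToKerr_holds :
    nonempty_finalStateDecomposition_of_convergesToKerr.{u} := by
  intro 𝓢 𝒟 M a k h hM ha
  obtain ⟨τ₀, Ψ, hΨ, ht⟩ := h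
  -- the hole chart, transported to the boosted background of the trivial motion
  obtain ⟨Ψ', hΨ', htrunc, hlate, hslab⟩ := 𝓢.exists_isLateChart_of_eq hΨ.toIsLateChart ht
    (boostedKerrBackground 1 0 M a) (boostedKerrBackground_one_zero M a)
  -- the excision radius
  set C₀ : ℝ := max (Kerr.rPlus M a) 0 + 1 with hC₀
  set ρ : ℝ → ℝ := fun t ↦ C₀ + √t with hρ
  have hρc : Continuous ρ := continuous_const.add Real.continuous_sqrt
  have hρC : ∀ t, C₀ ≤ ρ t := fun t ↦ le_add_of_nonneg_right (Real.sqrt_nonneg t)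
  have hρtop : Tendsto ρ atTop atTop := tendsto_atTop_add_const_left _ C₀ Real.tendsto_sqrt_atTop
  have hρdiv : Tendsto (fun t ↦ ρ t / t) atTop (𝓝 0) := by
    have h1 : Tendsto (fun t : ℝ ↦ C₀ / t) atTop (𝓝 0) := tendsto_const_nhds.div_atTop tendsto_id
    have h2 : Tendsto (fun t : ℝ ↦ √t / t) atTop (𝓝 0) := by
      simp_rw [Real.sqrt_div_self]
      exact tendsto_inv_atTop_zero.comp Real.tendsto_sqrt_atTop
    simpa [hρ, add_div] using h1.add h2
  -- the flat domain
  have hc0 : Continuous fun y : E4 ↦ y 0 := PiLp.continuous_apply 2 _ 0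
  let U : Opens E4 := ⟨{x | τ₀ < x 0 ∧ ρ (x 0) < Kerr.radius a x},
    (isOpen_lt continuous_const hc0).inter (isOpen_lt (hρc.comp hc0) (Kerr.continuous_radius a))⟩
  have hUK : (Minkowski.backgroundOn U).domain ≤ (Kerr.background M a).domain := by
    intro x hx
    change max (Kerr.rPlus M a) 0 < Kerr.radius a x
    have h2 : ρ (x 0) < Kerr.radius a x := hx.2
    have h3 := hρC (x 0)
    linarith
  have hUρ : ∀ z ∈ U, ρ (z 0) < Kerr.radius a z := fun z hz ↦ hz.2
  refine ⟨{
    N := 1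
    mass := fun _ ↦ M
    spin := fun _ ↦ a
    mass_pos := fun _ ↦ hM
    abs_spin_le_mass := fun _ ↦ ha
    motion := fun _ ↦ (1, 0)
    τ₀ := τ₀
    chart := fun _ ↦ Ψ'
    isLateChart := fun _ ↦ hΨ'
    tendsto_truncDeviationCk := fun _ R ↦ htrunc R
    exists_pairwise_disjoint := fun _ ↦ ⟨0, Subsingleton.pairwise⟩
    excision := fun _ ↦ ρ
    tendsto_excision_div := fun _ ↦ hρdiv
    flatDomain := U
    setOf_lt_excision_subset_flatDomain := fun x hx ↦ ⟨hx.1, by simpa using hx.2 0⟩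
    flatChart := Ψ ∘ Opens.inclusion hUK
    isLateChart_flat := 𝓢.isLateChart_backgroundOn_comp_inclusion hΨ.toIsLateChart hUK
    tendsto_deviationCk_flat := 𝓢.tendsto_deviationCk_backgroundOn hΨ.contMDiff ht hρtop hUρ hUK
    diff_subset_causalPast := ?_ }⟩
  intro p hp
  have hp' : p ∈ 𝒟 \ Ψ '' (Kerr.background M a).lateRegion τ₀ := by
    refine ⟨hp.1, fun hpΨ ↦ hp.2 (Or.inl ?_)⟩
    rw [← hlate] at hpΨ
    exact Set.mem_iUnion.mpr ⟨0, hpΨ⟩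
  have hJ := hΨ.diff_subset_causalPast hp'
  refine LorentzianMetric.causalFuture_mono ?_ hJ
  rw [← hslab]
  exact (Set.subset_iUnion (fun i : Fin 1 ↦ Ψ' '' (boostedKerrBackground 1 0 M a).timeSlab τ₀)
    0).trans Set.subset_union_left

end Literature.Geometry.Lorentzian

end
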